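import Literature.Probability.Percolation.PlanarDuality
import Literature.Probability.LatticeModels.DomainDiscretisation
import HarnessLib

/-!
# Winding of a closed dual walk around primal vertices: helper for stub
`stub_kernel_flatMisdockDictionary` of line `hitting-tournament` (crux `LagHandOff`,
stmt-CriticalPhenomena-10268)

A walk `K` of the square lattice on FACE indices (faces of `ℤ²` indexed by their lower-left
corner, as in `Crossings.lean` / `PlanarDuality.lean`) is a walk of the dual lattice; its dual
edge `{a, a'}` crosses the primal edge `e` with `dualEdge e = {a, a'}`.  The faces of the lattice
of face indices are the PRIMAL vertices: the primal vertex `p` is the face with lower-left corner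
`p - (1, 1)` of that lattice.  Hence `walkWinding K (p - 1)` (`PlanarDuality.lean`) is the
winding number of the dual walk `K` around the primal vertex `p` (signed number of crossings by
`K` of the horizontal primal half-line from `p` to the right), and the flow identities of
`PlanarDuality.lean` become, for a CLOSED dual walk `K`:

* `wnd_eq_of_adj` — equal winding around lattice neighbours `p ∼ p'` whose primal edge is not
  crossed by `K` (`dualEdge {p, p'} ∉ K.edges`); `wnd_eq_of_walk` along a primal walk;
* `wnd_ne_of_count_eq_one` — across a vertical primal edge crossed exactly once the winding
  jumps;
* `wnd_eq_zero_of_*` — no winding far above / below / right / left of the faces of `K`.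

The packaged consequence `stub_kernel_flatMisdock_windingContradiction` is the discrete
Jordan-curve contradiction used twice by the flat misdock dictionary: a closed dual walk within
distance `D` of a point `x`, crossing the edge below a vertex `z` exactly once, never crossing
the column below `z - e₁`, and avoiding the edges of a primal walk from `z` to a vertex `w` at
distance `> √2 D` from `x`, does not exist.

References: H. Kesten, *Percolation theory for mathematicians* (1982), §2.2 (discrete Jordan
curve arguments by winding numbers); G. Grimmett, *Percolation* (1999), §11.2.
-/

noncomputable section

open Literature.Probability.Percolation Literature.Probability.LatticeModels

namespace Summit.CriticalPhenomena.CardyFormulaZ2.Cruxes.LagHandOff.HittingTournament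

open SimpleGraph

namespace KernelFlatDictionary

/-! ### Coordinates -/

/-- `(p - 1) + e₀ = p - e₁` in `ℤ²` (`1 = e₀ + e₁`). -/
theorem sub_one_add_e0 (p : Site 2) : p - 1 + Pi.single 0 1 = p - Pi.single 1 1 := by
  rw [one_eq_single_add_single]; abel

/-- `(p - 1) + e₁ = p - e₀` in `ℤ²`. -/
theorem sub_one_add_e1 (p : Site 2) : p - 1 + Pi.single 1 1 = p - Pi.single 0 1 := by
  rw [one_eq_single_add_single]; abel

/-- `(p - 1) + e₀ + e₁ = p` in `ℤ²`. -/
theorem sub_one_add_e0_add_e1 (p : Site 2) : p - 1 + Pi.single 0 1 + Pi.single 1 1 = p := by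
  rw [one_eq_single_add_single]; abel

/-- `(p - 1) + e₁ + e₀ = p` in `ℤ²`. -/
theorem sub_one_add_e1_add_e0 (p : Site 2) : p - 1 + Pi.single 1 1 + Pi.single 0 1 = p := by
  rw [one_eq_single_add_single]; abel

/-! ### The winding number of a dual walk around a primal vertex

Throughout, the winding number of the dual walk `K` (a lattice walk on face indices) around
the PRIMAL vertex `p` is `walkWinding K (p - 1)`: the signed number of crossings by `K` of the
primal half-line from `p` to the right. -/

/-- Moving the vertex to the right across a primal edge not crossed by `K`. -/
theorem wnd_right {f g : Site 2} (K : (zdGraph 2).Walk f g) {p : Site 2}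
    (h : dualEdge s(p, p + Pi.single 0 1) ∉ K.edges) :
    walkWinding K (p - 1) = walkWinding K (p + Pi.single 0 1 - 1) := by
  rw [show p + Pi.single 0 1 - 1 = p - 1 + Pi.single 0 1 by abel]
  apply walkWinding_eq_walkWinding_right
  rwa [sub_one_add_e0_add_e1, sub_one_add_e0, ← dualEdge_horizontal]

/-- Moving the vertex upwards across a primal edge not crossed by the CLOSED walk `K`. -/
theorem wnd_up {f : Site 2} (K : (zdGraph 2).Walk f f) {p : Site 2}
    (h : dualEdge s(p, p + Pi.single 1 1) ∉ K.edges) :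
    walkWinding K (p - 1) = walkWinding K (p + Pi.single 1 1 - 1) := by
  have hsum : (K.darts.map fun d => hCross (p - 1) d.fst d.snd).sum = 0 := by
    refine List.sum_eq_zero fun t ht => ?_
    obtain ⟨d, hd, rfl⟩ := List.mem_map.1 ht
    refine hCross_eq_zero_of_ne fun heq => h ?_
    rw [sub_one_add_e1_add_e0, sub_one_add_e1] at heq
    rw [dualEdge_vertical, ← heq]
    exact List.mem_map.2 ⟨d, hd, rfl⟩
  have := walkWinding_sub_walkWinding_up K (p - 1)
  rw [hsum, sub_self, show p + Pi.single 1 1 - 1 = p - 1 + Pi.single 1 1 by abel] at *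
  linarith

/-- **Invariance across uncrossed edges**: for a closed dual walk `K` and lattice neighbours
`p ∼ p'` whose primal edge is not crossed by `K`, the winding numbers agree. -/
theorem wnd_eq_of_adj {f : Site 2} (K : (zdGraph 2).Walk f f) {p p' : Site 2}
    (hpp' : (zdGraph 2).Adj p p') (h : dualEdge s(p, p') ∉ K.edges) :
    walkWinding K (p - 1) = walkWinding K (p' - 1) := by
  rcases stepKind_of_adj hpp' with ⟨h0, h1⟩ | ⟨h0, h1⟩ | ⟨h1, h0⟩ | ⟨h1, h0⟩
  · obtain rfl : p' = p + Pi.single 0 1 := by simp [Site.eq_iff_two, h0, h1]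
    exact wnd_right K h
  · obtain rfl : p = p' + Pi.single 0 1 := by simp [Site.eq_iff_two, h0, h1]
    rw [Sym2.eq_swap] at h
    exact (wnd_right K h).symm
  · obtain rfl : p' = p + Pi.single 1 1 := by simp [Site.eq_iff_two, h0, h1]
    exact wnd_up K h
  · obtain rfl : p = p' + Pi.single 1 1 := by simp [Site.eq_iff_two, h0, h1]
    rw [Sym2.eq_swap] at h
    exact (wnd_up K h).symm

/-- **Invariance along primal walks**: a closed dual walk winds equally around the two ends of
a primal walk none of whose edges it crosses. -/
theorem wnd_eq_of_walk {f : Site 2} (K : (zdGraph 2).Walk f f) {z w : Site 2}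
    (γ : (zdGraph 2).Walk z w) (h : ∀ e ∈ γ.edges, dualEdge e ∉ K.edges) :
    walkWinding K (z - 1) = walkWinding K (w - 1) := by
  induction γ with
  | nil => rfl
  | cons hadj γ ih =>
    rw [wnd_eq_of_adj K hadj (h _ (by simp)), ih fun e he => h e (by simp [he])]

/-! ### No winding away from the walk -/

/-- No winding around a vertex above every face of the walk. -/
theorem wnd_eq_zero_of_row_lt {f g : Site 2} (K : (zdGraph 2).Walk f g) {p : Site 2}
    (h : ∀ a ∈ K.support, a 1 < p 1) : walkWinding K (p - 1) = 0 :=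
  walkWinding_eq_zero_of_le (N := p 1 - 1) (fun a ha => by have := h a ha; omega)
    (by simp)

/-- No winding around a vertex at or below the row of every face of the walk. -/
theorem wnd_eq_zero_of_le_row {f g : Site 2} (K : (zdGraph 2).Walk f g) {p : Site 2}
    (h : ∀ a ∈ K.support, p 1 ≤ a 1) : walkWinding K (p - 1) = 0 :=
  walkWinding_eq_zero_of_ge (L := p 1) h (by simp)

/-- No winding around a vertex to the right of every face of the walk. -/
theorem wnd_eq_zero_of_col_lt {f g : Site 2} (K : (zdGraph 2).Walk f g) {p : Site 2}
    (h : ∀ a ∈ K.support, a 0 < p 0) : walkWinding K (p - 1) = 0 := by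
  induction K with
  | nil => rfl
  | cons hadj K ih =>
    rename_i a a' _
    rw [walkWinding_cons, ih fun c hc => h c (by simp [hc]), add_zero]
    have ha := h a (by simp)
    have ha' := h a' (by simp)
    unfold stepWinding upStep
    simp only [Pi.sub_apply, Pi.one_apply]
    split_ifs <;> omega

/-- The rows of finitely many sites are bounded above. -/
theorem exists_row_le (l : List (Site 2)) : ∃ N : ℤ, ∀ a ∈ l, a 1 ≤ N := by
  induction l with
  | nil => exact ⟨0, by simp⟩
  | cons a l ih =>
    obtain ⟨N, hN⟩ := ih
    exact ⟨max (a 1) N, fun c hc => by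
      rcases List.mem_cons.1 hc with rfl | hc
      · exact le_max_left _ _
      · exact (hN c hc).trans (le_max_right _ _)⟩

/-- The rows of finitely many sites are bounded below. -/
theorem exists_le_row (l : List (Site 2)) : ∃ L : ℤ, ∀ a ∈ l, L ≤ a 1 := by
  induction l with
  | nil => exact ⟨0, by simp⟩
  | cons a l ih =>
    obtain ⟨L, hL⟩ := ih
    exact ⟨min (a 1) L, fun c hc => by
      rcases List.mem_cons.1 hc with rfl | hc
      · exact min_le_left _ _
      · exact (min_le_right _ _).trans (hL c hc)⟩

/-- No winding of a CLOSED dual walk around a vertex to the left of every face of the walk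
(climb the column of the vertex, which `K` never crosses, until above the walk). -/
theorem wnd_eq_zero_of_lt_col {f : Site 2} (K : (zdGraph 2).Walk f f) {p : Site 2}
    (h : ∀ a ∈ K.support, p 0 < a 0) : walkWinding K (p - 1) = 0 := by
  obtain ⟨N, hN⟩ := exists_row_le K.support
  have hclimb : ∀ k : ℕ,
      walkWinding K (p + Pi.single 1 (k : ℤ) - 1) = walkWinding K (p - 1) := by
    intro k
    induction k with
    | zero => simp
    | succ k ih =>
      rw [← ih, Nat.cast_succ, Pi.single_add, ← add_assoc]
      refine (wnd_up K fun hmem => ?_).symm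
      rw [dualEdge_vertical, add_sub_assoc] at hmem
      have := h _ (K.snd_mem_support_of_mem_edges hmem)
      simp at this
  rw [← hclimb (N + 1 - p 1).toNat]
  refine wnd_eq_zero_of_row_lt K fun a ha => ?_
  have h1 := hN a ha
  have h2 := Int.self_le_toNat (N + 1 - p 1)
  simp only [Pi.add_apply, Pi.single_eq_same]
  omega

/-! ### The jump across an edge crossed once -/

/-- The step across the top side of the face `u` has `hCross u = ±1`. -/
theorem hCross_eq_or_of_eq {u x y : Site 2}
    (h : s(x, y) = s(u + Pi.single 1 1, u + Pi.single 1 1 + Pi.single 0 1)) :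
    hCross u x y = 1 ∨ hCross u x y = -1 := by
  rcases Sym2.eq_iff.1 h with ⟨rfl, rfl⟩ | ⟨rfl, rfl⟩
  · left
    simp [hCross]
  · right
    simp [hCross]

/-- If a list of lattice darts uses the top side of the face `u` exactly once, its total
`hCross u` is `±1`. -/
theorem sum_hCross_of_count_eq_one (u : Site 2) :
    ∀ l : List ((zdGraph 2).Dart),
      (l.map Dart.edge).count s(u + Pi.single 1 1, u + Pi.single 1 1 + Pi.single 0 1) = 1 →
      (l.map fun d => hCross u d.fst d.snd).sum = 1 ∨
        (l.map fun d => hCross u d.fst d.snd).sum = -1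
  | [], h => by simp at h
  | d :: l, h => by
    rw [List.map_cons, List.count_cons] at h
    rw [List.map_cons, List.sum_cons]
    by_cases hd : d.edge = s(u + Pi.single 1 1, u + Pi.single 1 1 + Pi.single 0 1)
    · rw [hd, beq_self_eq_true, if_pos rfl] at h
      have h0 : (l.map Dart.edge).count
          s(u + Pi.single 1 1, u + Pi.single 1 1 + Pi.single 0 1) = 0 := by omega
      have hrest : (l.map fun d => hCross u d.fst d.snd).sum = 0 := by
        refine List.sum_eq_zero fun t ht => ?_
        obtain ⟨d', hd', rfl⟩ := List.mem_map.1 ht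
        refine hCross_eq_zero_of_ne fun heq => ?_
        rw [List.count_eq_zero] at h0
        exact h0 (List.mem_map.2 ⟨d', hd', heq⟩)
      rw [hrest, add_zero]
      exact hCross_eq_or_of_eq hd
    · have hne : (d.edge == s(u + Pi.single 1 1, u + Pi.single 1 1 + Pi.single 0 1)) = false :=
        beq_eq_false_iff_ne.2 hd
      rw [hne] at h
      simp only [Bool.false_eq_true, if_false, add_zero] at h
      have h0 : hCross u d.fst d.snd = 0 := hCross_eq_zero_of_ne hd
      rw [h0, zero_add]
      exact sum_hCross_of_count_eq_one u l h

/-- **Jump relation**: a closed dual walk crossing the vertical primal edge `{p, p + e₁}` exactly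
once winds differently around `p` and `p + e₁`. -/
theorem wnd_ne_of_count_eq_one {f : Site 2} (K : (zdGraph 2).Walk f f) {p : Site 2}
    (h : K.edges.count (dualEdge s(p, p + Pi.single 1 1)) = 1) :
    walkWinding K (p - 1) ≠ walkWinding K (p + Pi.single 1 1 - 1) := by
  have hid := walkWinding_sub_walkWinding_up K (p - 1)
  rw [sub_self, neg_zero, zero_sub] at hid
  have h' : (K.darts.map Dart.edge).count
      s(p - 1 + Pi.single 1 1, p - 1 + Pi.single 1 1 + Pi.single 0 1) = 1 := by
    rwa [sub_one_add_e1_add_e0, sub_one_add_e1, ← dualEdge_vertical]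
  have hsum := sum_hCross_of_count_eq_one (p - 1) K.darts h'
  rw [show p + Pi.single 1 1 - 1 = p - 1 + Pi.single 1 1 by abel]
  intro heq
  rw [heq, sub_self] at hid
  rcases hsum with hs | hs <;> rw [hs] at hid <;> norm_num at hid

/-! ### Faces near a point, vertices far from it -/

/-- A face index within distance `D` of `x` (at mesh `δ > 0`) has both rescaled coordinates
within `D` of those of `x`. -/
theorem abs_coord_le_of_dist_le {δ D : ℝ} {a : Site 2} {x : ℂ}
    (h : dist (meshPoint δ a) x ≤ D) : |δ * a 0 - x.re| ≤ D ∧ |δ * a 1 - x.im| ≤ D := by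
  rw [Complex.dist_eq] at h
  constructor
  · have := (Complex.abs_re_le_norm (meshPoint δ a - x)).trans h
    rwa [Complex.sub_re, meshPoint_re] at this
  · have := (Complex.abs_im_le_norm (meshPoint δ a - x)).trans h
    rwa [Complex.sub_im, meshPoint_im] at this

/-- **No winding around a far vertex**: if every face of the closed dual walk `K` is within
distance `D` of `x` and a rescaled coordinate of the vertex `w` is farther than `D` from that of
`x`, then `walkWinding K (w - 1) = 0`. -/
theorem wnd_eq_zero_of_far {f : Site 2} (K : (zdGraph 2).Walk f f) {w : Site 2} {x : ℂ}
    {δ D : ℝ} (hδ : 0 < δ) (h4 : ∀ a ∈ K.support, dist (meshPoint δ a) x ≤ D)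
    (h5 : D < |δ * w 0 - x.re| ∨ D < |δ * w 1 - x.im|) : walkWinding K (w - 1) = 0 := by
  have hco := fun a ha => abs_coord_le_of_dist_le (h4 a ha)
  have hlt : ∀ {s t : ℤ}, δ * s < δ * t → s < t := fun h =>
    Int.cast_lt.1 (lt_of_mul_lt_mul_left h hδ.le)
  rcases h5 with h5 | h5
  · rcases lt_abs.1 h5 with h5 | h5
    · refine wnd_eq_zero_of_col_lt K fun a ha => hlt ?_
      have := (abs_le.1 (hco a ha).1).2
      linarith
    · refine wnd_eq_zero_of_lt_col K fun a ha => hlt ?_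
      have := (abs_le.1 (hco a ha).1).1
      linarith
  · rcases lt_abs.1 h5 with h5 | h5
    · refine wnd_eq_zero_of_row_lt K fun a ha => hlt ?_
      have := (abs_le.1 (hco a ha).2).2
      linarith
    · refine wnd_eq_zero_of_le_row K fun a ha => (hlt ?_).le
      have := (abs_le.1 (hco a ha).2).1
      linarith

/-- **No winding around a vertex below the walk along an uncrossed column**: if the closed dual
walk `K` never crosses the vertical primal edges `{p - e₁, p}` of the column of `z` strictly
below `z`, then the winding around `z - e₁` vanishes. -/
theorem wnd_sub_eq_zero_of_column {f : Site 2} (K : (zdGraph 2).Walk f f) {z : Site 2}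
    (h2 : ∀ p : Site 2, p 0 = z 0 → p 1 < z 1 →
      dualEdge s(p - Pi.single 1 1, p) ∉ K.edges) :
    walkWinding K (z - Pi.single 1 1 - 1) = 0 := by
  obtain ⟨L, hL⟩ := exists_le_row K.support
  have hdesc : ∀ k : ℕ, walkWinding K (z - Pi.single 1 ((k : ℤ) + 1) - 1) =
      walkWinding K (z - Pi.single 1 1 - 1) := by
    intro k
    induction k with
    | zero => simp
    | succ k ih =>
      rw [← ih, Nat.cast_succ]
      set q : Site 2 := z - Pi.single 1 ((k : ℤ) + 1) with hq
      have hq' : z - Pi.single 1 ((k : ℤ) + 1 + 1) = q - Pi.single 1 1 := by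
        rw [hq, Pi.single_add]; abel
      rw [hq']
      refine (wnd_eq_of_adj K (adj_sub_single_one q) ?_).symm
      rw [Sym2.eq_swap]
      refine h2 q (by simp [hq]) ?_
      simp only [hq, Pi.sub_apply, Pi.single_eq_same]
      omega
  rw [← hdesc (z 1 - L).toNat]
  refine wnd_eq_zero_of_le_row K fun a ha => ?_
  have h1 := hL a ha
  have h3 := Int.self_le_toNat (z 1 - L)
  simp only [Pi.sub_apply, Pi.single_eq_same]
  omega

end KernelFlatDictionary

open KernelFlatDictionary in
/-- **The discrete Jordan-curve contradiction of the flat misdock dictionary** (aux stub for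
`stub_kernel_flatMisdockDictionary`).  There is no closed dual walk `K` (a lattice walk on face
indices, its dual edge `{a, a'}` crossing the primal edge `e` with `dualEdge e = {a, a'}`) such
that: `K` crosses the vertical edge `{z - e₁, z}` below the vertex `z` exactly once; `K` crosses
no vertical edge of the column of `z` strictly below `z - e₁`; `K` crosses no edge of some primal
walk from `z` to a vertex `w`; every face of `K` is within distance `D` of a point `x` (mesh
`δ > 0`) while `w` is at distance `> √2 D` from `x`.  Indeed the winding number of `K` would
vanish at `w` (far from `K`), hence at `z` (invariance along the walk), and at `z - e₁` (descend
the uncrossed column), contradicting the jump across `{z - e₁, z}`.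
[cite: KestenPTM1982, §2.2 (discrete Jordan curve arguments via winding numbers)] -/
theorem stub_kernel_flatMisdock_windingContradiction : ∀ {f : Site 2} (K : (zdGraph 2).Walk f f)
    {z w : Site 2} {x : ℂ} {δ D : ℝ}, 0 < δ →
    K.edges.count (dualEdge s(z - Pi.single 1 1, z)) = 1 →
    (∀ p : Site 2, p 0 = z 0 → p 1 < z 1 → dualEdge s(p - Pi.single 1 1, p) ∉ K.edges) →
    ∀ γ : (zdGraph 2).Walk z w, (∀ e ∈ γ.edges, dualEdge e ∉ K.edges) →
    (∀ a ∈ K.support, dist (meshPoint δ a) x ≤ D) →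
    Real.sqrt 2 * D < dist (meshPoint δ w) x → False := by
  intro f K z w x δ D hδ h1 h2 γ h3 h4 h5
  -- the far vertex has a far coordinate
  have h5' : D < |δ * w 0 - x.re| ∨ D < |δ * w 1 - x.im| := by
    by_contra hcon
    push Not at hcon
    have hle := Complex.norm_le_sqrt_two_mul_max (meshPoint δ w - x)
    rw [Complex.sub_re, Complex.sub_im, meshPoint_re, meshPoint_im] at hle
    have hmax : max |δ * w 0 - x.re| |δ * w 1 - x.im| ≤ D := max_le hcon.1 hcon.2
    have : dist (meshPoint δ w) x ≤ Real.sqrt 2 * D := by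
      rw [Complex.dist_eq]
      exact hle.trans (mul_le_mul_of_nonneg_left hmax (Real.sqrt_nonneg _))
    linarith
  have hw : walkWinding K (w - 1) = 0 := wnd_eq_zero_of_far K hδ h4 h5'
  have hz : walkWinding K (z - 1) = 0 := (wnd_eq_of_walk K γ h3).trans hw
  have hbelow : walkWinding K (z - Pi.single 1 1 - 1) = 0 := wnd_sub_eq_zero_of_column K h2
  have hjump := wnd_ne_of_count_eq_one K (p := z - Pi.single 1 1) (by rwa [sub_add_cancel])
  rw [sub_add_cancel, hbelow, hz] at hjump
  exact hjump rfl

end Summit.CriticalPhenomena.CardyFormulaZ2.Cruxes.LagHandOff.HittingTournament
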